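import Summits.QuantumFields.YangMills.Theorems.FluctuationComparisonRegPrIntLOrganTangentAnchorFreeOscillation
import Summits.QuantumFields.YangMills.Theorems.FluctuationComparisonRegPrIntLOrganTangentFlatAnchorEven
import Summits.QuantumFields.YangMills.Theorems.FluctuationComparisonRegPrIntLOrganTangentGaugeConjugateProbe
import Summits.QuantumFields.YangMills.Theorems.FluctuationComparisonRegPrIntLOrganTangentPullbackSquare
import HarnessLib

/-!
# Crux `FluctuationComparisonRegPrIntL` (stmt-QuantumFields-20520, rung R3), PATH-B organ, v18 (H-currency): TN-GR-12 —
# SEED-PROPORTIONAL GRADIENT ROWS FROM THE PAIR CLAUSE (flat anchor + window path + gauge copy; DEFINITION-FREE, hypothesis-form in the path data)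

Cell `ym3-torus` (YM ladder rung R3 = continuum `SU(2)` Yang–Mills on the three-torus — a RUNG: NOT d = 4, NOT infinite volume, NOT a mass gap, NOT Clay).
Width seat `ym3-torus-px19` (gen 19), helper on crux stmt-QuantumFields-20520 (`--kind proof --supports stmt-QuantumFields-20520 --as helper`, count-neutral,
no registry ∕ binder ∕ `Lines/` edit, default heartbeats, `autoImplicit false`).  LEAD `ym-ust-20520-w3` g25 WORD №17 «GO SEED-PROPORTIONAL GRADIENT ROWS»
on ideator `ym-r3-idea-1` g28 №3 (C) TN-GR-12.

WHY (TN-GR-12).  The LIN knit's pull-back (✓p805782 2a ∕ ✓2a-W ∕ ✓∕⧗2a-O) consumes a uniform GRADIENT ROW `|R (update U b (U b·expPt u)) − R U| ≤ g b·(‖u‖∕θ)`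
at window points; ✓p807878 GA supplies `g := Bρ∕rA` from the analyticity rows (β) — volume-free but NOT proportional to the seed letters, so LINᵘ-H's budget
line `θ·x′ ≤ (Ctr + εd)·x + δ_j` fails at `h ≡ 0` (`x = 0` but `(Bρ∕rA)ᵀ·Y ≠ 0`).  The pair clause ITSELF gives seed-proportional rows: the first difference
at the FLAT configuration is second-order small by inversion-evenness (✓p799177 `flat_anchor_of_clause`: `|Δ_{(a,u)} R(1)| ≤ (k a a∕2)·(‖u‖∕θ)²`, `hinv` from
gauge invariance by ✓p793256 `flatBond_apply_inv_eq`), and brick T (✓p797413 `firstDiff_window_path`) transports it along any window path from `1`, each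
step `(bᵢ, vᵢ)` costing the DECAYING letter `k bᵢ a·(‖vᵢ‖∕θ)`; regrouped by bond with per-bond path masses `ν b′` (✓2a `gradient_pathSum_le`), the row is
`(k a a∕2)·(‖u‖∕θ) + Σ_{b′} k b′ a·ν b′` — LINEAR in the clause letters' column at `a`, no volume factor.  A general window point `U` is reached through
its gauge copy `U^σ` at the end of the path, for a gauge-invariant `R`, by cst-p1's CONJ-PROBE (✓`…OrganTangentGaugeConjugateProbe.exists_conjugateProbe`:
the probe vector rotates, `‖u′‖ ≤ √3·‖u‖`, `dist1` and windows unchanged).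

WHAT (all hypothesis-form in the PATH DATA — which window paths the knit feeds is LEAD's call: (P-b′) ✓p798086's chord paths have volume-uniform
per-bond COUNTS `N` (then `ν = N·σ`, §0), an axial-comb path adapted to the probe bond would give `ν b′ ≲ 1 + tdist(a, b′)`, absorbed by the letters'
exponential decay):
* §0 `colMass_le_of_countP` — per-bond mass from a per-bond count and a step bound: `Σ_{(bᵢ,vᵢ): bᵢ = b′} sz vᵢ ≤ N·σ`.
* §1 ★★`gradientRow_of_clause_windowPath` — clause TEXT `h` (`θ, r, k ≥ 0`) + flat evenness `hinv` + a window path from `1` with brick T's window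
  hypotheses for the probe `(a, u)` (`‖u‖∕θ ≤ r`, `dist1 (expPt u) < θ`) + per-bond masses `ν` ⟹
  `|R (update Uend a (Uend a·expPt u)) − R Uend| ≤ ((k a a∕2)·(‖u‖∕θ) + Σ_{b′} k b′ a·ν b′)·(‖u‖∕θ)`; `_le` edition with any uniform `g a ≥ (k a a∕2)·r + Σ_{b′} k b′ a·ν b′`.
* §2 ★★`gradientRow_of_clause_gaugeCopy` — the same at ANY `U` whose gauge copy `GaugeField.gaugeAct σ U` is the path's end, for `GaugeField.GaugeInvariant R`
  (evenness DISCHARGED by ✓`flatBond_apply_inv_eq`), cap `√3·(‖u‖∕θ) ≤ r`, the probe-excitation windows asked for every `w` with `dist1 (expPt w) ≤ dist1 (expPt u)`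
  (the rotated probe is such a `w`): `… ≤ ((k a a∕2)·(√3·(‖u‖∕θ)) + Σ_{b′} k b′ a·ν b′)·(√3·(‖u‖∕θ))`; `_le` edition with `g a ≥ √3·((k a a∕2)·r + Σ_{b′} k b′ a·ν b′)`
  in GA's∕2a-O's `hG` shape `g a·(‖u‖∕θ)`.

HONEST FRAMING: compositions of landed bookkeeping lemmas over HYPOTHESIS clauses and path data; the window paths and their masses `ν` are NOT constructed
here; nothing of Bałaban's analysis is asserted or proved; LINᵘ-H ∕ JENᵘ-H ∕ O1ᵘ-H v2 ∕ S1aᴴ ∕ 26243 ∕ S2α′ ∕ S2β OPEN; crux 20520 `FluctuationComparisonRegPrIntL` ∕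
`YM3TorusSU2` NOT proved; no summit ∕ sub-problem statement is proved; rung R3 = SU(2) YM₃ on T³ at fixed lattice data — NOT d = 4, NOT infinite volume, NOT a
mass gap, NOT Clay; the Yang–Mills mass gap is NOT proved.  [folklore] bookkeeping.
-/

set_option autoImplicit false

noncomputable section

namespace Summit.QuantumFields.YangMills.Theorems.OrganTangentGradientFromClause

open scoped BigOperators
open Function
open Literature.MathematicalPhysics.QuantumFieldTheory.Balaban1983to89
open T4CubeChartGnomonic (SU2)
open T4CubeChartExp (expPt toE)
open Summit.QuantumFields.YangMills.Theorems.OrganTangentTelescopeWindowPath (firstDiff_window_path)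
open Summit.QuantumFields.YangMills.Theorems.OrganTangentAnchorFreeOscillation (flat_anchor_of_clause)
open Summit.QuantumFields.YangMills.Theorems.OrganTangentFlatAnchorEven (flatBond_apply_inv_eq)
open Summit.QuantumFields.YangMills.Theorems.OrganTangentGaugeConjugateProbe (exists_conjugateProbe)
open Summit.QuantumFields.YangMills.Theorems.OrganTangentPullbackSquare (gradient_pathSum_le)

/-! ## §0 Per-bond masses from per-bond counts -/

section Count

variable {ι M : Type*} [DecidableEq ι]

/-- A per-bond COUNT `≤ N` and a step bound `sz ≤ σ` give the per-bond MASS `≤ N·σ` ((P-b′)'s export ⟹ §1's `ν`). [folklore] -/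
theorem colMass_le_of_countP (sz : M → ℝ) (path : List (ι × M)) (b' : ι) {N : ℕ} {σ : ℝ}
    (hcount : path.countP (fun q => decide (q.1 = b')) ≤ N) (hsz : ∀ q ∈ path, sz q.2 ≤ σ) (hσ : 0 ≤ σ) :
    ((path.filter (fun q => decide (q.1 = b'))).map (fun q => sz q.2)).sum ≤ (N : ℝ) * σ := by
  have h1 : ((path.filter (fun q => decide (q.1 = b'))).map (fun q => sz q.2)).sum
      ≤ ((path.filter (fun q => decide (q.1 = b'))).map (fun _ => σ)).sum :=
    List.sum_le_sum (fun q hq => hsz q (List.mem_of_mem_filter hq))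
  have h2 : ((path.filter (fun q => decide (q.1 = b'))).map (fun _ => σ)).sum
      = ((path.filter (fun q => decide (q.1 = b'))).length : ℝ) * σ := by
    rw [List.map_const', List.sum_replicate, nsmul_eq_mul]
  have h3 : (path.filter (fun q => decide (q.1 = b'))).length = path.countP (fun q => decide (q.1 = b')) :=
    (List.countP_eq_length_filter).symm
  rw [h2, h3] at h1
  exact h1.trans (mul_le_mul_of_nonneg_right (by exact_mod_cast hcount) hσ)

end Count

/-! ## §1 The gradient row at the end of a window path from the flat configuration -/

section Organ

variable {P : Params} {j : ℕ} [DecidableEq (PBond P j)]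

/-- ★★ **SEED-PROPORTIONAL GRADIENT ROW AT THE END OF A WINDOW PATH.**  For the `HClauseSq θ r k R` TEXT `h` (`k ≥ 0`), inversion-evenness at the flat
configuration `hinv`, a probe `(a, u)` (`‖u‖∕θ ≤ r`, `dist1 (expPt u) < θ`), a path of right exponential one-bond moves from `1` with sizes `≤ r`, all prefixes
and their `(a,u)`-excitations `θ`-small, and per-bond path masses `Σ_{(bᵢ,vᵢ): bᵢ = b′} ‖vᵢ‖∕θ ≤ ν b′`:
`|R (update Uend a (Uend a·expPt u)) − R Uend| ≤ ((k a a∕2)·(‖u‖∕θ) + Σ_{b′} k b′ a·ν b′)·(‖u‖∕θ)` (brick T's telescope from ✓`flat_anchor_of_clause`'s anchor,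
regrouped by bond with ✓2a `gradient_pathSum_le`). [folklore] -/
theorem gradientRow_of_clause_windowPath {θ r : ℝ} (hθ : 0 < θ) {k : PBond P j → PBond P j → ℝ} (hk : ∀ b b', 0 ≤ k b b')
    {R : GaugeField P j (Matrix.specialUnitaryGroup (Fin 2) ℂ) → ℝ}
    (h : ∀ (b b' : PBond P j) (v v' : Fin 3 → ℝ) (U V W Z : GaugeField P j (Matrix.specialUnitaryGroup (Fin 2) ℂ)),
      ‖v‖ ≤ r * θ → ‖v'‖ ≤ r * θ → PlaqSmall θ U → PlaqSmall θ V → PlaqSmall θ W → PlaqSmall θ Z →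
      (∀ e, e ≠ b → V e = U e) → V b = U b * expPt v → (∀ e, e ≠ b' → W e = U e) → W b' = U b' * expPt v' →
      (∀ e, e ≠ b' → Z e = V e) → Z b' = V b' * expPt v' →
      |R Z - R V - R W + R U| ≤ k b b' * (‖v‖ / θ) * (‖v'‖ / θ))
    (hinv : ∀ (b : PBond P j) (g : SU2), R (update 1 b g⁻¹) = R (update 1 b g))
    (a : PBond P j) (u : Fin 3 → ℝ) (hu : ‖u‖ / θ ≤ r) (huθ : dist1 (expPt u) < θ)
    (path : List (PBond P j × (Fin 3 → ℝ))) (hsz : ∀ p ∈ path, ‖p.2‖ / θ ≤ r)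
    (hgood : ∀ n ≤ path.length,
      PlaqSmall θ ((path.take n).foldl (fun U p => update U p.1 (U p.1 * expPt p.2)) (1 : GaugeField P j SU2)) ∧
      PlaqSmall θ (update ((path.take n).foldl (fun U p => update U p.1 (U p.1 * expPt p.2)) (1 : GaugeField P j SU2)) a
        (((path.take n).foldl (fun U p => update U p.1 (U p.1 * expPt p.2)) (1 : GaugeField P j SU2)) a * expPt u)))
    (ν : PBond P j → ℝ) (hν : ∀ b', ((path.filter (fun q => decide (q.1 = b'))).map (fun q => ‖q.2‖ / θ)).sum ≤ ν b') :
    |R (update (path.foldl (fun U p => update U p.1 (U p.1 * expPt p.2)) (1 : GaugeField P j SU2)) a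
        ((path.foldl (fun U p => update U p.1 (U p.1 * expPt p.2)) (1 : GaugeField P j SU2)) a * expPt u)) -
      R (path.foldl (fun U p => update U p.1 (U p.1 * expPt p.2)) (1 : GaugeField P j SU2))|
      ≤ (k a a / 2 * (‖u‖ / θ) + ∑ b' : PBond P j, k b' a * ν b') * (‖u‖ / θ) := by
  have hG := flat_anchor_of_clause hθ h hinv a u hu huθ
  have htel := firstDiff_window_path hθ h a u hu path (1 : GaugeField P j SU2) (k a a / 2 * (‖u‖ / θ)) hsz hgood hG
  have hreg : (path.map (fun p => k p.1 a * (‖p.2‖ / θ))).sum ≤ ∑ b' : PBond P j, k b' a * ν b' :=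
    gradient_pathSum_le (fun w : Fin 3 → ℝ => ‖w‖ / θ) (fun d => k d a) (fun d => hk d a) path ν hν
  refine htel.trans (mul_le_mul_of_nonneg_right ?_ (div_nonneg (norm_nonneg u) hθ.le))
  linarith

/-- ★ The same with a UNIFORM row `g a ≥ (k a a∕2)·r + Σ_{b′} k b′ a·ν b′` (GA's∕2a-O's `hG` shape `g a·(‖u‖∕θ)`). [folklore] -/
theorem gradientRow_of_clause_windowPath_le {θ r : ℝ} (hθ : 0 < θ) {k : PBond P j → PBond P j → ℝ} (hk : ∀ b b', 0 ≤ k b b')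
    {R : GaugeField P j (Matrix.specialUnitaryGroup (Fin 2) ℂ) → ℝ}
    (h : ∀ (b b' : PBond P j) (v v' : Fin 3 → ℝ) (U V W Z : GaugeField P j (Matrix.specialUnitaryGroup (Fin 2) ℂ)),
      ‖v‖ ≤ r * θ → ‖v'‖ ≤ r * θ → PlaqSmall θ U → PlaqSmall θ V → PlaqSmall θ W → PlaqSmall θ Z →
      (∀ e, e ≠ b → V e = U e) → V b = U b * expPt v → (∀ e, e ≠ b' → W e = U e) → W b' = U b' * expPt v' →
      (∀ e, e ≠ b' → Z e = V e) → Z b' = V b' * expPt v' →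
      |R Z - R V - R W + R U| ≤ k b b' * (‖v‖ / θ) * (‖v'‖ / θ))
    (hinv : ∀ (b : PBond P j) (g : SU2), R (update 1 b g⁻¹) = R (update 1 b g))
    (a : PBond P j) (u : Fin 3 → ℝ) (hu : ‖u‖ / θ ≤ r) (huθ : dist1 (expPt u) < θ)
    (path : List (PBond P j × (Fin 3 → ℝ))) (hsz : ∀ p ∈ path, ‖p.2‖ / θ ≤ r)
    (hgood : ∀ n ≤ path.length,
      PlaqSmall θ ((path.take n).foldl (fun U p => update U p.1 (U p.1 * expPt p.2)) (1 : GaugeField P j SU2)) ∧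
      PlaqSmall θ (update ((path.take n).foldl (fun U p => update U p.1 (U p.1 * expPt p.2)) (1 : GaugeField P j SU2)) a
        (((path.take n).foldl (fun U p => update U p.1 (U p.1 * expPt p.2)) (1 : GaugeField P j SU2)) a * expPt u)))
    (ν : PBond P j → ℝ) (hν : ∀ b', ((path.filter (fun q => decide (q.1 = b'))).map (fun q => ‖q.2‖ / θ)).sum ≤ ν b')
    (g : PBond P j → ℝ) (hg : k a a / 2 * r + ∑ b' : PBond P j, k b' a * ν b' ≤ g a) :
    |R (update (path.foldl (fun U p => update U p.1 (U p.1 * expPt p.2)) (1 : GaugeField P j SU2)) a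
        ((path.foldl (fun U p => update U p.1 (U p.1 * expPt p.2)) (1 : GaugeField P j SU2)) a * expPt u)) -
      R (path.foldl (fun U p => update U p.1 (U p.1 * expPt p.2)) (1 : GaugeField P j SU2))| ≤ g a * (‖u‖ / θ) := by
  have hmain := gradientRow_of_clause_windowPath hθ hk h hinv a u hu huθ path hsz hgood ν hν
  refine hmain.trans (mul_le_mul_of_nonneg_right ?_ (div_nonneg (norm_nonneg u) hθ.le))
  have h1 : k a a / 2 * (‖u‖ / θ) ≤ k a a / 2 * r := mul_le_mul_of_nonneg_left hu (by linarith [hk a a])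
  linarith

/-! ## §2 The gradient row at a general window point through its gauge copy (CONJ-PROBE) -/

/-- ★★ **SEED-PROPORTIONAL GRADIENT ROW AT A GENERAL POINT, VIA THE GAUGE COPY.**  For a GAUGE-INVARIANT `R` (flat evenness discharged by
✓`flatBond_apply_inv_eq`), a gauge transformation `σ` and a window path from `1` ending at the gauge copy `GaugeField.gaugeAct σ U`, a probe `(a, u)` with
`√3·(‖u‖∕θ) ≤ r` and `dist1 (expPt u) < θ`, all prefixes `θ`-small and their `a`-excitations by EVERY `w` with `dist1 (expPt w) ≤ dist1 (expPt u)` `θ`-small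
(the rotated probe `Ad_{σ(a₊)} u` is such a `w`), and per-bond masses `ν`:
`|R (update U a (U a·expPt u)) − R U| ≤ ((k a a∕2)·(√3·(‖u‖∕θ)) + Σ_{b′} k b′ a·ν b′)·(√3·(‖u‖∕θ))`. [folklore] -/
theorem gradientRow_of_clause_gaugeCopy {θ r : ℝ} (hθ : 0 < θ) {k : PBond P j → PBond P j → ℝ} (hk : ∀ b b', 0 ≤ k b b')
    {R : GaugeField P j (Matrix.specialUnitaryGroup (Fin 2) ℂ) → ℝ}
    (h : ∀ (b b' : PBond P j) (v v' : Fin 3 → ℝ) (U V W Z : GaugeField P j (Matrix.specialUnitaryGroup (Fin 2) ℂ)),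
      ‖v‖ ≤ r * θ → ‖v'‖ ≤ r * θ → PlaqSmall θ U → PlaqSmall θ V → PlaqSmall θ W → PlaqSmall θ Z →
      (∀ e, e ≠ b → V e = U e) → V b = U b * expPt v → (∀ e, e ≠ b' → W e = U e) → W b' = U b' * expPt v' →
      (∀ e, e ≠ b' → Z e = V e) → Z b' = V b' * expPt v' →
      |R Z - R V - R W + R U| ≤ k b b' * (‖v‖ / θ) * (‖v'‖ / θ))
    (hR : GaugeField.GaugeInvariant R)
    (U : GaugeField P j SU2) (σ : GaugeTransf P j SU2) (a : PBond P j) (u : Fin 3 → ℝ)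
    (hu : Real.sqrt 3 * (‖u‖ / θ) ≤ r) (huθ : dist1 (expPt u) < θ)
    (path : List (PBond P j × (Fin 3 → ℝ))) (hsz : ∀ p ∈ path, ‖p.2‖ / θ ≤ r)
    (hend : path.foldl (fun U p => update U p.1 (U p.1 * expPt p.2)) (1 : GaugeField P j SU2) = GaugeField.gaugeAct σ U)
    (hpre : ∀ n ≤ path.length, PlaqSmall θ ((path.take n).foldl (fun U p => update U p.1 (U p.1 * expPt p.2)) (1 : GaugeField P j SU2)))
    (hexc : ∀ n ≤ path.length, ∀ w : Fin 3 → ℝ, dist1 (expPt w) ≤ dist1 (expPt u) →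
      PlaqSmall θ (update ((path.take n).foldl (fun U p => update U p.1 (U p.1 * expPt p.2)) (1 : GaugeField P j SU2)) a
        (((path.take n).foldl (fun U p => update U p.1 (U p.1 * expPt p.2)) (1 : GaugeField P j SU2)) a * expPt w)))
    (ν : PBond P j → ℝ) (hν : ∀ b', ((path.filter (fun q => decide (q.1 = b'))).map (fun q => ‖q.2‖ / θ)).sum ≤ ν b') :
    |R (update U a (U a * expPt u)) - R U|
      ≤ (k a a / 2 * (Real.sqrt 3 * (‖u‖ / θ)) + ∑ b' : PBond P j, k b' a * ν b') * (Real.sqrt 3 * (‖u‖ / θ)) := by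
  obtain ⟨u', hu'n, -, hu'd, -, -, hdiff⟩ := exists_conjugateProbe R hR σ U a u
  rw [hdiff, ← hend]
  have hinv : ∀ (b : PBond P j) (g : SU2), R (update 1 b g⁻¹) = R (update 1 b g) := fun b g => flatBond_apply_inv_eq hR b g
  have hu'θ : ‖u'‖ / θ ≤ Real.sqrt 3 * (‖u‖ / θ) := by
    rw [mul_div_assoc']
    exact div_le_div_of_nonneg_right hu'n hθ.le
  have hu'r : ‖u'‖ / θ ≤ r := hu'θ.trans hu
  have hu'dist : dist1 (expPt u') < θ := by rw [hu'd]; exact huθ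
  have hgood : ∀ n ≤ path.length,
      PlaqSmall θ ((path.take n).foldl (fun U p => update U p.1 (U p.1 * expPt p.2)) (1 : GaugeField P j SU2)) ∧
      PlaqSmall θ (update ((path.take n).foldl (fun U p => update U p.1 (U p.1 * expPt p.2)) (1 : GaugeField P j SU2)) a
        (((path.take n).foldl (fun U p => update U p.1 (U p.1 * expPt p.2)) (1 : GaugeField P j SU2)) a * expPt u')) :=
    fun n hn => ⟨hpre n hn, hexc n hn u' hu'd.le⟩
  have hmain := gradientRow_of_clause_windowPath hθ hk h hinv a u' hu'r hu'dist path hsz hgood ν hν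
  refine hmain.trans ?_
  have h0 : 0 ≤ ‖u'‖ / θ := div_nonneg (norm_nonneg _) hθ.le
  have hS : 0 ≤ ∑ b' : PBond P j, k b' a * ν b' := by
    refine Finset.sum_nonneg (fun b' _ => mul_nonneg (hk b' a) ?_)
    exact le_trans (List.sum_nonneg (by
      intro x hx
      obtain ⟨q, _, rfl⟩ := List.mem_map.1 hx
      exact div_nonneg (norm_nonneg _) hθ.le)) (hν b')
  have hka : 0 ≤ k a a / 2 := by linarith [hk a a]
  have h1 : k a a / 2 * (‖u'‖ / θ) + ∑ b' : PBond P j, k b' a * ν b'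
      ≤ k a a / 2 * (Real.sqrt 3 * (‖u‖ / θ)) + ∑ b' : PBond P j, k b' a * ν b' := by
    linarith [mul_le_mul_of_nonneg_left hu'θ hka]
  exact mul_le_mul h1 hu'θ h0 (by positivity)

/-- ★ The same with a UNIFORM row `g a ≥ √3·((k a a∕2)·r + Σ_{b′} k b′ a·ν b′)` in GA's∕2a-O's `hG` shape `g a·(‖u‖∕θ)`. [folklore] -/
theorem gradientRow_of_clause_gaugeCopy_le {θ r : ℝ} (hθ : 0 < θ) {k : PBond P j → PBond P j → ℝ} (hk : ∀ b b', 0 ≤ k b b')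
    {R : GaugeField P j (Matrix.specialUnitaryGroup (Fin 2) ℂ) → ℝ}
    (h : ∀ (b b' : PBond P j) (v v' : Fin 3 → ℝ) (U V W Z : GaugeField P j (Matrix.specialUnitaryGroup (Fin 2) ℂ)),
      ‖v‖ ≤ r * θ → ‖v'‖ ≤ r * θ → PlaqSmall θ U → PlaqSmall θ V → PlaqSmall θ W → PlaqSmall θ Z →
      (∀ e, e ≠ b → V e = U e) → V b = U b * expPt v → (∀ e, e ≠ b' → W e = U e) → W b' = U b' * expPt v' →
      (∀ e, e ≠ b' → Z e = V e) → Z b' = V b' * expPt v' →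
      |R Z - R V - R W + R U| ≤ k b b' * (‖v‖ / θ) * (‖v'‖ / θ))
    (hR : GaugeField.GaugeInvariant R)
    (U : GaugeField P j SU2) (σ : GaugeTransf P j SU2) (a : PBond P j) (u : Fin 3 → ℝ)
    (hu : Real.sqrt 3 * (‖u‖ / θ) ≤ r) (huθ : dist1 (expPt u) < θ)
    (path : List (PBond P j × (Fin 3 → ℝ))) (hsz : ∀ p ∈ path, ‖p.2‖ / θ ≤ r)
    (hend : path.foldl (fun U p => update U p.1 (U p.1 * expPt p.2)) (1 : GaugeField P j SU2) = GaugeField.gaugeAct σ U)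
    (hpre : ∀ n ≤ path.length, PlaqSmall θ ((path.take n).foldl (fun U p => update U p.1 (U p.1 * expPt p.2)) (1 : GaugeField P j SU2)))
    (hexc : ∀ n ≤ path.length, ∀ w : Fin 3 → ℝ, dist1 (expPt w) ≤ dist1 (expPt u) →
      PlaqSmall θ (update ((path.take n).foldl (fun U p => update U p.1 (U p.1 * expPt p.2)) (1 : GaugeField P j SU2)) a
        (((path.take n).foldl (fun U p => update U p.1 (U p.1 * expPt p.2)) (1 : GaugeField P j SU2)) a * expPt w)))
    (ν : PBond P j → ℝ) (hν : ∀ b', ((path.filter (fun q => decide (q.1 = b'))).map (fun q => ‖q.2‖ / θ)).sum ≤ ν b')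
    (g : PBond P j → ℝ) (hg : Real.sqrt 3 * (k a a / 2 * r + ∑ b' : PBond P j, k b' a * ν b') ≤ g a) :
    |R (update U a (U a * expPt u)) - R U| ≤ g a * (‖u‖ / θ) := by
  have hmain := gradientRow_of_clause_gaugeCopy hθ hk h hR U σ a u hu huθ path hsz hend hpre hexc ν hν
  refine hmain.trans ?_
  have h0 : 0 ≤ ‖u‖ / θ := div_nonneg (norm_nonneg _) hθ.le
  have hS : 0 ≤ ∑ b' : PBond P j, k b' a * ν b' := by
    refine Finset.sum_nonneg (fun b' _ => mul_nonneg (hk b' a) ?_)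
    exact le_trans (List.sum_nonneg (by
      intro x hx
      obtain ⟨q, _, rfl⟩ := List.mem_map.1 hx
      exact div_nonneg (norm_nonneg _) hθ.le)) (hν b')
  have hka : 0 ≤ k a a / 2 := by linarith [hk a a]
  have h3 : 0 ≤ Real.sqrt 3 := Real.sqrt_nonneg 3
  -- `(A·(√3 s) + S)·(√3 s) ≤ (A·r + S)·(√3 s) = √3·(A r + S)·s ≤ g a·s`
  have h1 : k a a / 2 * (Real.sqrt 3 * (‖u‖ / θ)) ≤ k a a / 2 * r := mul_le_mul_of_nonneg_left hu hka
  have h13 : (1 : ℝ) ≤ Real.sqrt 3 := by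
    rw [show (1:ℝ) = Real.sqrt 1 by rw [Real.sqrt_one]]
    exact Real.sqrt_le_sqrt (by norm_num)
  calc (k a a / 2 * (Real.sqrt 3 * (‖u‖ / θ)) + ∑ b' : PBond P j, k b' a * ν b') * (Real.sqrt 3 * (‖u‖ / θ))
      ≤ (k a a / 2 * r + ∑ b' : PBond P j, k b' a * ν b') * (Real.sqrt 3 * (‖u‖ / θ)) :=
        mul_le_mul_of_nonneg_right (by linarith) (by positivity)
    _ = (Real.sqrt 3 * (k a a / 2 * r + ∑ b' : PBond P j, k b' a * ν b')) * (‖u‖ / θ) := by ring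
    _ ≤ g a * (‖u‖ / θ) := mul_le_mul_of_nonneg_right hg h0

end Organ

end Summit.QuantumFields.YangMills.Theorems.OrganTangentGradientFromClause

end
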